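import Mathlib
import HarnessLib

/-!
# LatticeQCDFlow / Scaling — the acceptance of an exact independence sampler against the
# exponential tilt `e^{βT}μ` of its own proposal law is NON-INCREASING in `β ≥ 0`
# (Chebyshev's integral inequality for one statistic)

HONEST FRAMING: exact (Metropolis-corrected) sampling algorithms for lattice gauge theory;
figures of merit are autocorrelation/cost numbers at stated couplings and volumes; no
continuum-physics claim.

Venture `LatticeQCDFlow` (cell pub-lqcd), topic `Scaling`; FANOUT row 3 (`s0-u1-a`, S0-B
implementation A, GEN-17).  NEW WORK of the cell (an elementary inequality), not a published result;
NO definition is introduced.  GEN-16 (`Scaling/IdentityFlowCouplingMonotone` etc.) proved the two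
closed-form ENVELOPES of the untrained (identity-flow) exact sampler — the Bhattacharyya ceiling
`Z(β/2)²/Z(β)` and the ESS `Z(β)²/Z(2β)` — monotone in the coupling and listed the acceptance ITSELF
as not claimed.  This file proves it, for every exponential-tilt family.  Setting (any measure space
`(Ω, ν)`): a proposal density `q ≥ 0`, a measurable statistic `T`; the sampler proposes from `qν` and
Metropolis-corrects against `p_β = q e^{βT}/M(β)`, `M(β) = ∫ q e^{βT} dν`; its equilibrium acceptance
is `acc(β) = ∫∫ min(p_β(x)q(y), p_β(y)q(x)) = N(β)/M(β)`, `N(β) = ∫∫ q(x)q(y)·min(e^{βT x}, e^{βT y})`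
(`tiltIMH_meanAccept_density_eq`).  Only the moments `∫ q e^{γT} < ∞` AT THE COUPLINGS COMPARED are
used, so statistics unbounded above (interior couplings of unbounded actions) are covered.

* §1 **Chebyshev's integral inequality** (weighted, any measure space):
  `integral_mul_mul_mul_integral_le_of_anticomonotone` (`(∫kFG)(∫k) ≤ (∫kF)(∫kG)` for `k ≥ 0`,
  `(F x − F y)(G x − G y) ≤ 0`), `integral_mul_integral_le_integral_mul_mul_of_comonotone`,
  `anticomonotone_of_monotone_antitone`, `comonotone_of_monotone_monotone` (functions of ONE statistic).
* §2 the overlap kernel `Φ_β(t) = ∫ q·min(1, e^{β(T − t)}) dν`: `integral_mul_mul_min_exp_eq` (inner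
  factorisation `q(x)e^{βT x}Φ_β(T x)`), `Φ` non-increasing in `β ≥ 0` and in `t`
  (`integral_mul_min_one_exp_antitone_param`, `integral_mul_min_one_exp_antitone`), auxiliaries
  `integrable_mul_min_one_exp`, `integral_mul_min_one_exp_mem_Icc`, `integrable_mul_exp_mul_overlap`,
  the Chebyshev step `integral_mul_exp_mul_overlap_mul_le`
  (`E_{p_{β′}}Φ_β(T) ≤ E_{p_β}Φ_β(T)`: `p_{β′} ∝ e^{(β′−β)T}p_β` is an INCREASING reweighting, `Φ_β ∘ T`
  antitone); **`tiltIMH_meanAccept_le_of_le`** (`0 ≤ β ≤ β′ ⇒ acc(β′) ≤ acc(β)`, pointwise hypotheses);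
  **`tiltIMH_meanAccept_antitoneOn`** (NON-INCREASING on `[0, ∞)`, moments for `γ ≥ 0`);
  **`tiltIMH_meanAccept_antitoneOn_Icc`** (on `[0, r]`, moments on `[0, r]`);
  **`tiltIMH_meanAccept_monotoneOn`** (NON-DECREASING on `(−∞, 0]`, moments for `γ ≤ 0`).

Sequels: `Scaling/IdentityFlowAcceptanceCouplingMonotone` (Wilson theories, U(1)), `…CouplingStrict`.
Presearch (corpus + galaxy): no published statement of this monotonicity found; Chebyshev's
inequality for oppositely ordered sequences is Hardy–Littlewood–Pólya, *Inequalities*, §2.17,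
Thms 43–44 [folklore].  Reading (value-free): for an exact sampler whose flow is the identity,
lowering the temperature of the target can only lower the equilibrium acceptance itself.
NOT CLAIMED: strictness (sequel); trained flows; any value at the cell's `(β, L)`; nothing re-scored.
-/


noncomputable section

namespace Summit.Ventures.LatticeQCDFlow.Theory2

open MeasureTheory Real Set

/-! ## §1 Chebyshev's integral inequality for comonotone and anti-comonotone pairs -/

section Chebyshev

variable {Ω : Type*} [MeasurableSpace Ω] {ν : Measure Ω} {k F G : Ω → ℝ}

/-- **Weighted Chebyshev integral inequality, anti-comonotone form**: for a weight `k ≥ 0` and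
real functions `F`, `G` with `(F x − F y)(G x − G y) ≤ 0` for all `x`, `y` (one goes up where the
other goes down), `(∫ k·F·G)(∫ k) ≤ (∫ k·F)(∫ k·G)`.  Proof: integrate the pointwise inequality
`k x · k y · (F x − F y)(G x − G y) ≤ 0` twice. [folklore: Chebyshev's inequality for oppositely
ordered functions, Hardy–Littlewood–Pólya *Inequalities* §2.17 Thm 43, integral form] -/
theorem integral_mul_mul_mul_integral_le_of_anticomonotone (hk : ∀ x, 0 ≤ k x)
    (hFG : ∀ x y, (F x - F y) * (G x - G y) ≤ 0) (hki : Integrable k ν)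
    (hkF : Integrable (fun x => k x * F x) ν) (hkG : Integrable (fun x => k x * G x) ν)
    (hkFG : Integrable (fun x => k x * (F x * G x)) ν) :
    (∫ x, k x * (F x * G x) ∂ν) * (∫ x, k x ∂ν)
      ≤ (∫ x, k x * F x ∂ν) * (∫ x, k x * G x ∂ν) := by
  set K : ℝ := ∫ x, k x ∂ν with hK
  set IF : ℝ := ∫ x, k x * F x ∂ν with hIF
  set IG : ℝ := ∫ x, k x * G x ∂ν with hIG
  set IFG : ℝ := ∫ x, k x * (F x * G x) ∂ν with hIFG
  -- the inner integral in `y` for fixed `x`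
  have inner : ∀ x, ∫ y, k y * ((F x - F y) * (G x - G y)) ∂ν
      = F x * G x * K - F x * IG - G x * IF + IFG := by
    intro x
    have e : (fun y => k y * ((F x - F y) * (G x - G y)))
        = fun y => F x * G x * k y - F x * (k y * G y) - G x * (k y * F y) + k y * (F y * G y) := by
      funext y; ring
    have h1 : Integrable (fun y => F x * G x * k y) ν := hki.const_mul _
    have h2 : Integrable (fun y => F x * (k y * G y)) ν := hkG.const_mul _
    have h3 : Integrable (fun y => G x * (k y * F y)) ν := hkF.const_mul _
    have h12 : Integrable (fun y => F x * G x * k y - F x * (k y * G y)) ν := h1.sub h2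
    have h123 : Integrable (fun y => F x * G x * k y - F x * (k y * G y) - G x * (k y * F y)) ν :=
      h12.sub h3
    rw [e, integral_add h123 hkFG, integral_sub h12 h3, integral_sub h1 h2, integral_const_mul,
      integral_const_mul, integral_const_mul]
  -- it is pointwise `≤ 0`, hence so is the double integral
  have hnonpos : ∫ x, k x * ∫ y, k y * ((F x - F y) * (G x - G y)) ∂ν ∂ν ≤ 0 := by
    refine integral_nonpos fun x => ?_
    refine mul_nonpos_of_nonneg_of_nonpos (hk x) (integral_nonpos fun y => ?_)
    exact mul_nonpos_of_nonneg_of_nonpos (hk y) (hFG x y)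
  -- expand the double integral: it equals `2 (K·IFG − IF·IG)`
  have e2 : (fun x => k x * ∫ y, k y * ((F x - F y) * (G x - G y)) ∂ν)
      = fun x => K * (k x * (F x * G x)) - IG * (k x * F x) - IF * (k x * G x) + IFG * k x := by
    funext x; rw [inner]; ring
  have g1 : Integrable (fun x => K * (k x * (F x * G x))) ν := hkFG.const_mul _
  have g2 : Integrable (fun x => IG * (k x * F x)) ν := hkF.const_mul _
  have g3 : Integrable (fun x => IF * (k x * G x)) ν := hkG.const_mul _
  have g4 : Integrable (fun x => IFG * k x) ν := hki.const_mul _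
  have g12 : Integrable (fun x => K * (k x * (F x * G x)) - IG * (k x * F x)) ν := g1.sub g2
  have g123 : Integrable (fun x => K * (k x * (F x * G x)) - IG * (k x * F x) - IF * (k x * G x)) ν :=
    g12.sub g3
  rw [e2, integral_add g123 g4, integral_sub g12 g3, integral_sub g1 g2, integral_const_mul,
    integral_const_mul, integral_const_mul, integral_const_mul] at hnonpos
  nlinarith [hnonpos]

/-- **Weighted Chebyshev integral inequality, comonotone form**: for a weight `k ≥ 0` and
`F`, `G` with `0 ≤ (F x − F y)(G x − G y)` for all `x`, `y`, `(∫ k·F)(∫ k·G) ≤ (∫ k·F·G)(∫ k)`.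
[folklore: Chebyshev's sum inequality, integral form] -/
theorem integral_mul_integral_le_integral_mul_mul_of_comonotone (hk : ∀ x, 0 ≤ k x)
    (hFG : ∀ x y, 0 ≤ (F x - F y) * (G x - G y)) (hki : Integrable k ν)
    (hkF : Integrable (fun x => k x * F x) ν) (hkG : Integrable (fun x => k x * G x) ν)
    (hkFG : Integrable (fun x => k x * (F x * G x)) ν) :
    (∫ x, k x * F x ∂ν) * (∫ x, k x * G x ∂ν)
      ≤ (∫ x, k x * (F x * G x) ∂ν) * (∫ x, k x ∂ν) := by
  have hFG' : ∀ x y, (F x - F y) * ((-G x) - (-G y)) ≤ 0 := fun x y => by nlinarith [hFG x y]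
  have hkG' : Integrable (fun x => k x * (-G x)) ν := by simpa [mul_neg] using hkG.neg
  have hkFG' : Integrable (fun x => k x * (F x * (-G x))) ν := by simpa [mul_neg] using hkFG.neg
  have h := integral_mul_mul_mul_integral_le_of_anticomonotone hk hFG' hki hkF hkG' hkFG'
  simp only [mul_neg, integral_neg, neg_mul] at h
  linarith

end Chebyshev

section Comonotone

variable {Ω : Type*}

/-- A monotone and an antitone function of ONE real statistic are anti-comonotone. [folklore] -/
theorem anticomonotone_of_monotone_antitone {T : Ω → ℝ} {f g : ℝ → ℝ} (hf : Monotone f)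
    (hg : Antitone g) (x y : Ω) :
    (f (T x) - f (T y)) * (g (T x) - g (T y)) ≤ 0 := by
  rcases le_total (T x) (T y) with h | h
  · exact mul_nonpos_of_nonpos_of_nonneg (sub_nonpos.2 (hf h)) (sub_nonneg.2 (hg h))
  · exact mul_nonpos_of_nonneg_of_nonpos (sub_nonneg.2 (hf h)) (sub_nonpos.2 (hg h))

/-- Two monotone functions of ONE real statistic `T` form a comonotone pair. [folklore] -/
theorem comonotone_of_monotone_monotone {T : Ω → ℝ} {f g : ℝ → ℝ} (hf : Monotone f)
    (hg : Monotone g) (x y : Ω) :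
    0 ≤ (f (T x) - f (T y)) * (g (T x) - g (T y)) := by
  rcases le_total (T x) (T y) with h | h
  · exact mul_nonneg_of_nonpos_of_nonpos (sub_nonpos.2 (hf h)) (sub_nonpos.2 (hg h))
  · exact mul_nonneg (sub_nonneg.2 (hf h)) (sub_nonneg.2 (hg h))

end Comonotone

/-! ## §2 The acceptance of μ-proposals against the tilt `e^{βT}μ` is non-increasing in `β ≥ 0` -/

section Tilt

variable {Ω : Type*} [MeasurableSpace Ω] {ν : Measure Ω} {q T : Ω → ℝ}

/-- The overlap kernel `s ↦ min(1, e^{βs})` is non-increasing in `β ≥ 0`. [folklore] -/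
theorem min_one_exp_mul_antitone_param {β β' : ℝ} (hβ : 0 ≤ β) (hββ' : β ≤ β') (s : ℝ) :
    min 1 (Real.exp (β' * s)) ≤ min 1 (Real.exp (β * s)) := by
  rcases le_or_gt 0 s with hs | hs
  · rw [min_eq_left (Real.one_le_exp (mul_nonneg hβ hs))]
    exact min_le_left _ _
  · exact min_le_min le_rfl (Real.exp_le_exp.2 (mul_le_mul_of_nonpos_right hββ' hs.le))

/-- The overlap kernel `t ↦ min(1, e^{β(u − t)})` is non-increasing in `t` for `β ≥ 0`. [folklore] -/
theorem min_one_exp_mul_sub_antitone {β : ℝ} (hβ : 0 ≤ β) (u : ℝ) :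
    Antitone fun t : ℝ => min 1 (Real.exp (β * (u - t))) := fun _ _ h =>
  min_le_min le_rfl (Real.exp_le_exp.2 (mul_le_mul_of_nonneg_left (by linarith) hβ))

/-- **Inner factorisation**: `∫ q(x)q(y)·min(e^{βT x}, e^{βT y}) dν(y)
= q(x)e^{βT x} · Φ_β(T x)` with `Φ_β(t) = ∫ q(y)·min(1, e^{β(T y − t)}) dν(y)`. [ours] -/
theorem integral_mul_mul_min_exp_eq (β : ℝ) (x : Ω) :
    ∫ y, q x * q y * min (Real.exp (β * T x)) (Real.exp (β * T y)) ∂ν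
      = q x * Real.exp (β * T x) * ∫ y, q y * min 1 (Real.exp (β * (T y - T x))) ∂ν := by
  rw [← integral_const_mul]
  refine integral_congr_ae (ae_of_all _ fun y => ?_)
  have hpos : 0 ≤ Real.exp (β * T x) := (Real.exp_pos _).le
  have e : Real.exp (β * T y) = Real.exp (β * T x) * Real.exp (β * (T y - T x)) := by
    rw [← Real.exp_add]; ring_nf
  have hmin : min (Real.exp (β * T x)) (Real.exp (β * T x) * Real.exp (β * (T y - T x)))
      = Real.exp (β * T x) * min 1 (Real.exp (β * (T y - T x))) := by
    rw [mul_min_of_nonneg _ _ hpos, mul_one]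
  simp only
  rw [e, hmin]; ring

variable (hq : ∀ x, 0 ≤ q x) (hqm : Measurable q) (hTm : Measurable T) (hqi : Integrable q ν)
include hq hqm hTm hqi

/-- The overlap integrand `y ↦ q(y)·min(1, e^{β(T y − t)})` is integrable (dominated by `q`). -/
theorem integrable_mul_min_one_exp (β t : ℝ) :
    Integrable (fun y => q y * min 1 (Real.exp (β * (T y - t)))) ν := by
  refine hqi.mono' ?_ (ae_of_all _ fun y => ?_)
  · exact (hqm.mul (measurable_const.min (Real.measurable_exp.comp
      (measurable_const.mul (hTm.sub measurable_const))))).aestronglyMeasurable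
  · have h1 : 0 ≤ min 1 (Real.exp (β * (T y - t))) := le_min zero_le_one (Real.exp_pos _).le
    rw [Real.norm_eq_abs, abs_of_nonneg (mul_nonneg (hq y) h1)]
    exact (mul_le_mul_of_nonneg_left (min_le_left _ _) (hq y)).trans_eq (mul_one _)

omit hqm hTm in
/-- `0 ≤ Φ_β(t) ≤ ∫ q`. [folklore] -/
theorem integral_mul_min_one_exp_mem_Icc (β t : ℝ) :
    ∫ y, q y * min 1 (Real.exp (β * (T y - t))) ∂ν ∈ Icc 0 (∫ y, q y ∂ν) := by
  constructor
  · exact integral_nonneg fun y => mul_nonneg (hq y) (le_min zero_le_one (Real.exp_pos _).le)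
  · refine integral_mono_of_nonneg (ae_of_all _ fun y =>
      mul_nonneg (hq y) (le_min zero_le_one (Real.exp_pos _).le))
      hqi (ae_of_all _ fun y => ?_)
    exact (mul_le_mul_of_nonneg_left (min_le_left _ _) (hq y)).trans_eq (mul_one _)

/-- `Φ_β` is non-increasing in `t` (for `β ≥ 0`). [ours] -/
theorem integral_mul_min_one_exp_antitone {β : ℝ} (hβ : 0 ≤ β) :
    Antitone fun t : ℝ => ∫ y, q y * min 1 (Real.exp (β * (T y - t))) ∂ν := by
  intro t t' htt'
  refine integral_mono (integrable_mul_min_one_exp hq hqm hTm hqi β t')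
    (integrable_mul_min_one_exp hq hqm hTm hqi β t) fun y => ?_
  exact mul_le_mul_of_nonneg_left (min_one_exp_mul_sub_antitone hβ (T y) htt') (hq y)

/-- `Φ_β` is non-increasing in `β ≥ 0` (pointwise in `t`). [ours] -/
theorem integral_mul_min_one_exp_antitone_param {β β' : ℝ} (hβ : 0 ≤ β) (hββ' : β ≤ β') (t : ℝ) :
    ∫ y, q y * min 1 (Real.exp (β' * (T y - t))) ∂ν
      ≤ ∫ y, q y * min 1 (Real.exp (β * (T y - t))) ∂ν := by
  refine integral_mono (integrable_mul_min_one_exp hq hqm hTm hqi β' t)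
    (integrable_mul_min_one_exp hq hqm hTm hqi β t) fun y => ?_
  exact mul_le_mul_of_nonneg_left (min_one_exp_mul_antitone_param hβ hββ' _) (hq y)

/-- `x ↦ q(x)e^{γT x}·Φ_β(T x)` is integrable (`Φ_β ∘ T` is a bounded antitone function of the
measurable statistic `T`). [ours] -/
theorem integrable_mul_exp_mul_overlap {β : ℝ} (hβ : 0 ≤ β) {γ : ℝ}
    (hγi : Integrable (fun x => q x * Real.exp (γ * T x)) ν) :
    Integrable (fun x => q x * Real.exp (γ * T x)
      * ∫ y, q y * min 1 (Real.exp (β * (T y - T x))) ∂ν) ν := by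
  have hΦm : Measurable fun x => ∫ y, q y * min 1 (Real.exp (β * (T y - T x))) ∂ν :=
    (integral_mul_min_one_exp_antitone hq hqm hTm hqi hβ).measurable.comp hTm
  have h := hγi.bdd_mul (c := ∫ y, q y ∂ν) hΦm.aestronglyMeasurable
    (ae_of_all _ fun x => by
      obtain ⟨h0, h1⟩ := integral_mul_min_one_exp_mem_Icc hq hqi β (T x)
      rw [Real.norm_eq_abs, abs_of_nonneg h0]
      exact h1)
  exact h.congr (ae_of_all _ fun x => by ring)

/-- **The Chebyshev step**: the reweighting `p_β → p_{β′}` (`0 ≤ β ≤ β′`, an INCREASING function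
`e^{(β′−β)T}` of the statistic) can only decrease the mean of the antitone statistic `Φ_β ∘ T`:
`(∫ q e^{β′T}Φ_β(T))·M(β) ≤ M(β′)·∫ q e^{βT}Φ_β(T)`. [ours] -/
theorem integral_mul_exp_mul_overlap_mul_le {β β' : ℝ} (hβ : 0 ≤ β) (hββ' : β ≤ β')
    (hβi : Integrable (fun x => q x * Real.exp (β * T x)) ν)
    (hβ'i : Integrable (fun x => q x * Real.exp (β' * T x)) ν) :
    (∫ x, q x * Real.exp (β' * T x) * ∫ y, q y * min 1 (Real.exp (β * (T y - T x))) ∂ν ∂ν)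
        * ∫ x, q x * Real.exp (β * T x) ∂ν
      ≤ (∫ x, q x * Real.exp (β' * T x) ∂ν)
        * ∫ x, q x * Real.exp (β * T x) * ∫ y, q y * min 1 (Real.exp (β * (T y - T x))) ∂ν ∂ν := by
  set Φ : ℝ → ℝ := fun t => ∫ y, q y * min 1 (Real.exp (β * (T y - t))) ∂ν with hΦ
  -- Chebyshev with weight `q e^{βT}`, `F = e^{(β'−β)T}` (monotone), `G = Φ_β ∘ T` (antitone)
  have hFG := anticomonotone_of_monotone_antitone (T := T)
    (f := fun t => Real.exp ((β' - β) * t)) (g := Φ)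
    (fun s t hst => Real.exp_le_exp.2 (mul_le_mul_of_nonneg_left hst (sub_nonneg.2 hββ')))
    (integral_mul_min_one_exp_antitone hq hqm hTm hqi hβ)
  have ekF : ∀ x, q x * Real.exp (β * T x) * Real.exp ((β' - β) * T x)
      = q x * Real.exp (β' * T x) := by
    intro x; rw [mul_assoc, ← Real.exp_add]; ring_nf
  have hk : ∀ x, 0 ≤ q x * Real.exp (β * T x) := fun x => mul_nonneg (hq x) (Real.exp_pos _).le
  have hkF : Integrable (fun x => q x * Real.exp (β * T x) * Real.exp ((β' - β) * T x)) ν := by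
    simp_rw [ekF]; exact hβ'i
  have hkG : Integrable (fun x => q x * Real.exp (β * T x) * Φ (T x)) ν :=
    integrable_mul_exp_mul_overlap hq hqm hTm hqi hβ hβi
  have hkFG : Integrable (fun x => q x * Real.exp (β * T x)
      * (Real.exp ((β' - β) * T x) * Φ (T x))) ν := by
    refine (integrable_mul_exp_mul_overlap hq hqm hTm hqi hβ hβ'i).congr
      (ae_of_all _ fun x => ?_)
    simp only
    rw [← ekF]; ring
  have cheb := integral_mul_mul_mul_integral_le_of_anticomonotone hk hFG hβi hkF hkG hkFG
  have e1 : ∫ x, q x * Real.exp (β * T x) * (Real.exp ((β' - β) * T x) * Φ (T x)) ∂ν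
      = ∫ x, q x * Real.exp (β' * T x) * Φ (T x) ∂ν :=
    integral_congr_ae (ae_of_all _ fun x => by simp only; rw [← ekF]; ring)
  have e2 : ∫ x, q x * Real.exp (β * T x) * Real.exp ((β' - β) * T x) ∂ν
      = ∫ x, q x * Real.exp (β' * T x) ∂ν :=
    integral_congr_ae (ae_of_all _ fun x => ekF x)
  rw [e1, e2] at cheb
  exact cheb

/-- **Two couplings**: for `0 ≤ β ≤ β′` with `q e^{βT}`, `q e^{β′T}` integrable and positive
partition integrals, `acc(β′) ≤ acc(β)`.  Proof: `acc(β') = E_{p_{β'}}[Φ_{β'}(T)] ≤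
E_{p_{β'}}[Φ_β(T)] ≤ E_{p_β}[Φ_β(T)] = acc(β)` — the kernel `Φ` decreases in `β`, and `p_{β'}` is an
increasing exponential reweighting of `p_β` while `Φ_β ∘ T` is antitone in `T` (the Chebyshev step).
[ours] -/
theorem tiltIMH_meanAccept_le_of_le {β β' : ℝ} (hβ : 0 ≤ β) (hββ' : β ≤ β')
    (hβi : Integrable (fun x => q x * Real.exp (β * T x)) ν)
    (hβ'i : Integrable (fun x => q x * Real.exp (β' * T x)) ν)
    (hMβ : 0 < ∫ x, q x * Real.exp (β * T x) ∂ν) (hMβ' : 0 < ∫ x, q x * Real.exp (β' * T x) ∂ν) :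
    (∫ x, ∫ y, q x * q y * min (Real.exp (β' * T x)) (Real.exp (β' * T y)) ∂ν ∂ν)
        / ∫ x, q x * Real.exp (β' * T x) ∂ν
      ≤ (∫ x, ∫ y, q x * q y * min (Real.exp (β * T x)) (Real.exp (β * T y)) ∂ν ∂ν)
        / ∫ x, q x * Real.exp (β * T x) ∂ν := by
  have hβ'0 : 0 ≤ β' := hβ.trans hββ'
  set Φ : ℝ → ℝ → ℝ := fun γ t => ∫ y, q y * min 1 (Real.exp (γ * (T y - t))) ∂ν with hΦ
  have hN : ∀ γ, (∫ x, ∫ y, q x * q y * min (Real.exp (γ * T x)) (Real.exp (γ * T y)) ∂ν ∂ν)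
      = ∫ x, q x * Real.exp (γ * T x) * Φ γ (T x) ∂ν := fun γ =>
    integral_congr_ae (ae_of_all _ fun x => integral_mul_mul_min_exp_eq γ x)
  rw [hN, hN, div_le_div_iff₀ hMβ' hMβ]
  -- Step 1: the kernel decreases in `β`
  have step1 : ∫ x, q x * Real.exp (β' * T x) * Φ β' (T x) ∂ν
      ≤ ∫ x, q x * Real.exp (β' * T x) * Φ β (T x) ∂ν := by
    refine integral_mono (integrable_mul_exp_mul_overlap hq hqm hTm hqi hβ'0 hβ'i)
      (integrable_mul_exp_mul_overlap hq hqm hTm hqi hβ hβ'i) fun x => ?_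
    exact mul_le_mul_of_nonneg_left
      (integral_mul_min_one_exp_antitone_param hq hqm hTm hqi hβ hββ' (T x))
      (mul_nonneg (hq x) (Real.exp_pos _).le)
  -- Step 2: the Chebyshev step
  have cheb := integral_mul_exp_mul_overlap_mul_le hq hqm hTm hqi hβ hββ' hβi hβ'i
  -- combine
  calc (∫ x, q x * Real.exp (β' * T x) * Φ β' (T x) ∂ν) * ∫ x, q x * Real.exp (β * T x) ∂ν
      ≤ (∫ x, q x * Real.exp (β' * T x) * Φ β (T x) ∂ν) * ∫ x, q x * Real.exp (β * T x) ∂ν :=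
        mul_le_mul_of_nonneg_right step1 hMβ.le
    _ ≤ (∫ x, q x * Real.exp (β' * T x) ∂ν) * ∫ x, q x * Real.exp (β * T x) * Φ β (T x) ∂ν := cheb
    _ = (∫ x, q x * Real.exp (β * T x) * Φ β (T x) ∂ν) * ∫ x, q x * Real.exp (β' * T x) ∂ν :=
        mul_comm _ _

omit hqi in
/-- **THE ACCEPTANCE OF THE UNTRAINED SAMPLER IS NON-INCREASING IN THE COUPLING.**  For a base
measure `ν`, a proposal density `q ≥ 0` and a measurable statistic `T` with the `q`-exponential
moments for `γ ≥ 0` and positive partition integrals, the equilibrium acceptance of the exact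
(Metropolis-corrected) sampler proposing from `qν` against the tilt `p_β = q e^{βT}/∫ q e^{βT} dν`,
`acc(β) = (∫∫ q(x)q(y)·min(e^{βT x}, e^{βT y}) dν dν)/∫ q e^{βT} dν`, is NON-INCREASING on `[0, ∞)`.
[ours] -/
theorem tiltIMH_meanAccept_antitoneOn
    (hint : ∀ γ : ℝ, 0 ≤ γ → Integrable (fun x => q x * Real.exp (γ * T x)) ν)
    (hMpos : ∀ γ : ℝ, 0 ≤ γ → 0 < ∫ x, q x * Real.exp (γ * T x) ∂ν) :
    AntitoneOn (fun β : ℝ =>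
      (∫ x, ∫ y, q x * q y * min (Real.exp (β * T x)) (Real.exp (β * T y)) ∂ν ∂ν)
        / ∫ x, q x * Real.exp (β * T x) ∂ν) (Ici 0) := by
  intro β hβ β' hβ' hββ'
  exact tiltIMH_meanAccept_le_of_le hq hqm hTm (by simpa using hint 0 le_rfl) hβ hββ'
    (hint β hβ) (hint β' hβ') (hMpos β hβ) (hMpos β' hβ')

omit hqi in
/-- **Interval form** (LOCAL moments): with the `q`-exponential moments and positive partition
integrals for `γ ∈ [0, r]` only, the acceptance is non-increasing on `[0, r]` — tilt families based
at an interior coupling of a statistic unbounded above qualify. [ours] -/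
theorem tiltIMH_meanAccept_antitoneOn_Icc {r : ℝ}
    (hint : ∀ γ ∈ Icc 0 r, Integrable (fun x => q x * Real.exp (γ * T x)) ν)
    (hMpos : ∀ γ ∈ Icc 0 r, 0 < ∫ x, q x * Real.exp (γ * T x) ∂ν) :
    AntitoneOn (fun β : ℝ =>
      (∫ x, ∫ y, q x * q y * min (Real.exp (β * T x)) (Real.exp (β * T y)) ∂ν ∂ν)
        / ∫ x, q x * Real.exp (β * T x) ∂ν) (Icc 0 r) := by
  intro β hβ β' hβ' hββ'
  have hqi : Integrable q ν := by simpa using hint 0 ⟨le_rfl, hβ.1.trans hβ.2⟩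
  exact tiltIMH_meanAccept_le_of_le hq hqm hTm hqi hβ.1 hββ' (hint β hβ) (hint β' hβ')
    (hMpos β hβ) (hMpos β' hβ')

omit hqi in
/-- **… and NON-DECREASING on `(−∞, 0]`** (apply the theorem to `−T`; exponential moments are
needed for `γ ≤ 0` only): the acceptance is maximal at `β = 0`, where proposal and target coincide.
[ours] -/
theorem tiltIMH_meanAccept_monotoneOn
    (hint : ∀ γ : ℝ, γ ≤ 0 → Integrable (fun x => q x * Real.exp (γ * T x)) ν)
    (hMpos : ∀ γ : ℝ, γ ≤ 0 → 0 < ∫ x, q x * Real.exp (γ * T x) ∂ν) :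
    MonotoneOn (fun β : ℝ =>
      (∫ x, ∫ y, q x * q y * min (Real.exp (β * T x)) (Real.exp (β * T y)) ∂ν ∂ν)
        / ∫ x, q x * Real.exp (β * T x) ∂ν) (Iic 0) := by
  intro β hβ β' hβ' hββ'
  have hint' : ∀ γ : ℝ, 0 ≤ γ → Integrable (fun x => q x * Real.exp (γ * -T x)) ν :=
    fun γ hγ => by simpa only [mul_neg, neg_mul] using hint (-γ) (neg_nonpos.2 hγ)
  have hMpos' : ∀ γ : ℝ, 0 ≤ γ → 0 < ∫ x, q x * Real.exp (γ * -T x) ∂ν :=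
    fun γ hγ => by simpa only [mul_neg, neg_mul] using hMpos (-γ) (neg_nonpos.2 hγ)
  have h := tiltIMH_meanAccept_antitoneOn (T := fun x => -T x) hq hqm hTm.neg hint' hMpos'
    (mem_Ici.2 (neg_nonneg.2 (mem_Iic.1 hβ'))) (mem_Ici.2 (neg_nonneg.2 (mem_Iic.1 hβ)))
    (neg_le_neg hββ')
  simpa only [neg_mul_neg] using h

omit hqm hTm hqi in
/-- The acceptance in DENSITY form equals the ratio form: with the normalised tilt
`p_β = q e^{βT}/M(β)`, `∫∫ min(p_β(x) q(y), p_β(y) q(x)) = (∫∫ q q min(e^{βT x}, e^{βT y}))/M(β)`.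
[ours] -/
theorem tiltIMH_meanAccept_density_eq (hMpos : ∀ γ : ℝ, 0 < ∫ x, q x * Real.exp (γ * T x) ∂ν)
    (β : ℝ) :
    ∫ x, ∫ y, min (q x * Real.exp (β * T x) / (∫ z, q z * Real.exp (β * T z) ∂ν) * q y)
        (q y * Real.exp (β * T y) / (∫ z, q z * Real.exp (β * T z) ∂ν) * q x) ∂ν ∂ν
      = (∫ x, ∫ y, q x * q y * min (Real.exp (β * T x)) (Real.exp (β * T y)) ∂ν ∂ν)
          / ∫ x, q x * Real.exp (β * T x) ∂ν := by
  set M : ℝ := ∫ z, q z * Real.exp (β * T z) ∂ν with hM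
  have hM0 : 0 ≤ M := (hMpos β).le
  have e : ∀ x y, min (q x * Real.exp (β * T x) / M * q y) (q y * Real.exp (β * T y) / M * q x)
      = M⁻¹ * (q x * q y * min (Real.exp (β * T x)) (Real.exp (β * T y))) := by
    intro x y
    have hqx : 0 ≤ q x * q y := mul_nonneg (hq x) (hq y)
    rw [show q x * Real.exp (β * T x) / M * q y = (q x * q y) * Real.exp (β * T x) / M by ring,
      show q y * Real.exp (β * T y) / M * q x = (q x * q y) * Real.exp (β * T y) / M by ring,
      min_div_div_right hM0, ← mul_min_of_nonneg _ _ hqx]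
    ring
  simp_rw [e, integral_const_mul]
  rw [inv_mul_eq_div]

end Tilt

end Summit.Ventures.LatticeQCDFlow.Theory2
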